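import Summits.ResolutionOfSingularities.ResolutionOfSingularities.Theorems.PurelyInseparableDim4FrameTraps
import Summits.ResolutionOfSingularities.ResolutionOfSingularities.Theorems.PurelyInseparableDim4SpineTerminates
import HarnessLib
import HarnessLib.Audit.Tags

/-!
# Purely inseparable fourfolds — every trap needs a TRANSLATED move; no spine trap exists (F4-S is a theorem)
# [OURS · counted 0 · statements about OUR frame (`PurelyInseparableDim4Rules`/`Scope`), not about resolution]

Census cell «res-dim4-pi» (D-0157 DOOR 2), width seat `res-dim4-p-14`, brick PR-12o.  F4-S
`SpineTerminatesSomeRule p q` is a TREE THEOREM for every `q > 0` (p-10's capstone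
`spineTerminatesSomeRule_of_pos`, chain typ-1 → p-14 → p-10 → p-7 → p-11 → p-5 → p-10,
WORD #30 (a)).  Read against the trap census (eng-w5 / typ-3g7: «spine_only = 0 / 595 traps — every trap
uses at least one translated move»), this DEF-FREE file turns the observation into theorems:

* **`exists_translationForced_of_isTrap`**: if some permissible rule wins the spine game over `K`, every
  nonempty trap `T` over `K` contains a state `s` and a permissible coordinate centre `S` such that EVERY
  answer to `S` staying in `T` is TRANSLATED (no `SpineEdge` along `S` from `s` into `T`) — player B is
  forced off the chart origins somewhere;
* **`not_exists_spineTrap_of_pos`** (unconditional, every field of characteristic `p`, every `q > 0`): NO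
  SPINE TRAP EXISTS (a set of `q`-fold states in which every permissible centre has a chart-ORIGIN answer
  inside the set) — the kernel floor under «spine_only = 0»;
* `exists_translationForced_of_isTrap_of_pos` — the first statement made unconditional for `q > 0`.

Nothing here proves resolution of singularities in dimension ≥ 4 / characteristic `p`; counted 0;
AI work, weaker than expert review.
bears_on: LADDER-RESOLUTION:D157-DOOR2 (res-dim4-pi · PR-12o). Supports stmt-ResolutionOfSingularities-16155
(helper).
-/

set_option linter.dupNamespace false

noncomputable section

namespace Summit.ResolutionOfSingularities.ResolutionOfSingularities.Theorems.PIDim4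

namespace TrapsNeedTranslation

open Literature.AlgebraicGeometry.Resolution

variable {K : Type} [Field K] [DecidableEq K] {q : ℕ}

/-- **A spine-winning permissible rule forces a translated answer in every trap**: some state of the
trap has a permissible centre (the rule's) with NO chart-origin answer inside the trap. [folklore] -/
theorem exists_translationForced_of_isTrap {R : CentreRule K} (hR : IsPermissibleRule q R)
    (hspine : SpineTerminatesUnder q R) {T : Set (State K)} (hT : IsTrap q T) (hne : T.Nonempty) :
    ∃ s ∈ T, IsPermissibleCentre q (R s) s.F ∧ ∀ s' ∈ T, ¬ SpineEdge q (R s) s s' := by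
  by_contra hall
  push Not at hall
  apply hspine
  have hperm : ∀ s ∈ T, IsPermissibleCentre q (R s) s.F := fun s hs =>
    hR s ⟨Finset.univ, Finset.univ_nonempty, (hT s hs).1⟩
  have key : ∀ s : T, ∃ s' : T, IsPermissibleCentre q (R s.1) s.1.F ∧ SpineEdge q (R s.1) s.1 s'.1 := by
    rintro ⟨s, hs⟩
    obtain ⟨s', hs', hedge⟩ := hall s hs (hperm s hs)
    exact ⟨⟨s', hs'⟩, hperm s hs, hedge⟩
  choose f hf using key
  obtain ⟨s₀, hs₀⟩ := hne
  refine ⟨fun k => (f^[k] ⟨s₀, hs₀⟩).1, fun k => ?_⟩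
  show IsPermissibleCentre q (R (f^[k] ⟨s₀, hs₀⟩).1) (f^[k] ⟨s₀, hs₀⟩).1.F ∧
    SpineEdge q (R (f^[k] ⟨s₀, hs₀⟩).1) (f^[k] ⟨s₀, hs₀⟩).1 (f^[k + 1] ⟨s₀, hs₀⟩).1
  rw [Function.iterate_succ_apply']
  exact hf _

/-- Frame form: under F4-S, every nonempty trap over a field of characteristic `p` has a state and a
permissible centre all of whose in-trap answers are translated. [folklore] -/
theorem exists_translationForced_of_spineTerminatesSomeRule {p : ℕ} [CharP K p]
    (h : SpineTerminatesSomeRule p q) {T : Set (State K)} (hT : IsTrap q T) (hne : T.Nonempty) :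
    ∃ s ∈ T, ∃ S : Finset (Fin 4), IsPermissibleCentre q S s.F ∧ ∀ s' ∈ T, ¬ SpineEdge q S s s' := by
  obtain ⟨R, hR, hspine⟩ := h K
  obtain ⟨s, hs, hperm, hno⟩ := exists_translationForced_of_isTrap hR hspine hT hne
  exact ⟨s, hs, R s, hperm, hno⟩

/-- **UNCONDITIONAL (`q > 0`)**: every nonempty trap over a field of characteristic `p` has a
TRANSLATION-FORCED move (F4-S is the tree theorem `spineTerminatesSomeRule_of_pos`).
[folklore] -/
theorem exists_translationForced_of_isTrap_of_pos {p : ℕ} [CharP K p] (hq : 0 < q)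
    {T : Set (State K)} (hT : IsTrap q T) (hne : T.Nonempty) :
    ∃ s ∈ T, ∃ S : Finset (Fin 4), IsPermissibleCentre q S s.F ∧ ∀ s' ∈ T, ¬ SpineEdge q S s s' :=
  exists_translationForced_of_spineTerminatesSomeRule (spineTerminatesSomeRule_of_pos p hq)
    hT hne

/-- **NO SPINE TRAP EXISTS** (`q > 0`, every field of characteristic `p`): there is no nonempty set of
`q`-fold states in which every permissible coordinate centre has a chart-ORIGIN answer inside the set —
the theorem under the census' «spine_only = 0». [folklore] -/
theorem not_exists_spineTrap_of_pos (p : ℕ) (hq : 0 < q) (K : Type) [Field K] [CharP K p] [DecidableEq K] :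
    ¬ ∃ T : Set (State K), T.Nonempty ∧ ∀ s ∈ T,
      (q : ℕ∞) ≤ CentreBlowup.ordAlong Finset.univ s.F ∧
        ∀ S, IsPermissibleCentre q S s.F → ∃ s' ∈ T, SpineEdge q S s s' := by
  have h := spineTerminatesSomeRule_of_pos p hq
  rw [FrameTraps.spineTerminatesSomeRule_iff_forall_wins] at h
  exact (FrameTraps.forall_spineWins_iff_not_exists_spineTrap q).mp (h K)

end TrapsNeedTranslation

end Summit.ResolutionOfSingularities.ResolutionOfSingularities.Theorems.PIDim4

end
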